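import Mathlib.Order.WellFounded
import Mathlib.RingTheory.PrincipalIdealDomain
import Mathlib.Tactic.Ring
import Mathlib.Tactic.LinearCombination
import HarnessLib

/-!
# Elementary properties of (transfinite) Euclidean algorithms; normalised algorithms (Samuel 1971, §2)

Topic `Literature/Algebra/EuclideanDomain`, namespace `Literature.Algebra.EuclideanDomain.Algorithm`.
THEOREMS ONLY (no `def`, no instance, no named fact); everything PROVED.

## Source (read at the page)

P. Samuel, *About Euclidean rings*, J. Algebra **19** (1971) 282–301 [Samuel1971] (materialised
`paper:doi-10-1016-0021-8693-71-90110-4`, pp. 282–284), VERBATIM: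
* Definition 1 (p. 282): `W` a well-ordered set; an *algorithm* on the commutative ring `A` is a map `φ : A → W`
  with (E): «given `a, b ∈ A`, `b ≠ 0`, there exist `q` and `r` in `A` such that `a = bq + r` and `φ(r) < φ(b)`».
* Proposition 1 (p. 283): «For `b ∈ A`, `b ≠ 0`, we have `φ(b) > φ(0)`, so that `φ(0)` is the smallest element of
  `φ(A)`.» (Proof: `0 = bq + b₁`, `0 = b₁q₁ + b₂`, … a strictly decreasing sequence of values must stop at `bₙ = 0`.)
* Proposition 2 (p. 283): «An element `b ∈ A` such that `φ(b)` is the smallest element of `φ(A) − φ(0)` is a unit.»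
* Proposition 3 (p. 283): «Every ideal `𝔟` of the Euclidean ring `A` is principal.»
* Proposition 4 (p. 284): «If `φ : A → W` is an algorithm on a Euclidean ring `A`, then `φ₁`, defined by
  `φ₁(0) = φ(0)` and `φ₁(a) = inf_{b ∈ A, ab ≠ 0} φ(ab)` for `a ≠ 0`, is an algorithm such that
  (a) `φ₁(ac) ≥ φ₁(a)` for `ac ≠ 0`, (b) `φ₁(ac) = φ₁(a)` iff `Aac = Aa`, (c) `φ₁(a) ≤ φ(a)` for all `a ∈ A`.»
* Corollary 1 (p. 284): «If `φ₁` is as in Prop. 4, and if `u` is a unit, then `φ₁(u)` is the smallest element of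
  `φ₁(A) − φ₁(0)`», and the Remark: «The conclusion of Corollary 1 does not necessarily hold in general.  Take
  `A = ℤ`, `φ(n) = |n|` for `n ≠ 1`, `φ(1) = 2` (use `0` and `−1` as representatives mod `2`).»
* Example 1 (p. 284): an algorithm need not satisfy the divisibility condition `φ(ab) ≥ φ(a)`:
  «`A = ℤ`, `φ(n) = |n|` for `|n| ≠ 5`, and `φ(5) = 13`» (for `6 ≤ |n| ≤ 13` replace the representative `5` by
  `5 − |n|`); «we have `φ(5) > φ(10)`».

## What is formalised

For a commutative ring `R`, a well-ordered value type `W` (`LinearOrder`, `WellFoundedLT` — Samuel's transfinite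
generality) and `φ : R → W` satisfying (E) (hypothesis `hφ`, stated inline): Prop. 1 (`lt_of_ne_zero`), Prop. 2
(`isUnit_of_forall_le`), Prop. 3 (`isPrincipalIdealRing`), Prop. 4 as an existence statement whose clauses pin
`φ₁` down (`exists_normalised`: `φ₁(0) = φ(0)`, `φ₁(a) = min φ(ac)` over `ac ≠ 0`, (E), (a), (b), (c)),
Corollary 1 (`forall_le_of_isUnit`, for any algorithm satisfying (a)), the Remark's and Example 1's algorithms on `ℤ`
(`Int.remark_algorithm`, `Int.example1_algorithm`, `Int.example1_not_monotone`).

## Mathlib / tree search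

Mathlib: `EuclideanDomain` bundles an `ℕ`-like well-founded relation with the divisibility axiom `mul_left_not_lt`
built in; `WellFounded.min` / `min_mem` / `not_lt_min`.  Tree: `OfEuclideanFunction.lean` (Alaca–Williams'
`IsEuclideanFunction`, `ℕ`-valued WITH monotonicity; `isPrincipalIdealRing_of_euclideanFunction` for Motzkin's
form (iii)), `MotzkinConstruction.lean` (smallest algorithm).  The transfinite-valued Definition 1 and Prop. 4's
normalisation are not in the tree.
-/

namespace Literature.Algebra.EuclideanDomain.Algorithm

section General

variable {R : Type*} [CommRing R] {W : Type*} [LinearOrder W] [WellFoundedLT W] {φ : R → W}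

/-- **Proposition 1**: `φ(0) < φ(b)` for `b ≠ 0` (by well-founded induction on `φ(b)`: `0 = bq + r` with
`φ(r) < φ(b)`, and either `r = 0` or, inductively, `φ(0) < φ(r)`). [cite: Samuel1971, Prop. 1 (p. 283)] -/
theorem lt_of_ne_zero (hφ : ∀ a b : R, b ≠ 0 → ∃ q r : R, a = b * q + r ∧ φ r < φ b) {b : R} (hb : b ≠ 0) :
    φ 0 < φ b := by
  suffices H : ∀ w : W, ∀ b : R, φ b = w → b ≠ 0 → φ 0 < φ b from H _ b rfl hb
  intro w
  refine (wellFounded_lt (α := W)).induction (C := fun w ↦ ∀ b : R, φ b = w → b ≠ 0 → φ 0 < φ b) w ?_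
  intro w ih b hbw hb
  obtain ⟨q, r, -, hr⟩ := hφ 0 b hb
  by_cases hr0 : r = 0
  · rwa [hr0] at hr
  · exact (ih (φ r) (hbw ▸ hr) r rfl hr0).trans hr

/-- `φ(0)` is the smallest value. [cite: Samuel1971, Prop. 1 (p. 283)] -/
theorem apply_zero_le (hφ : ∀ a b : R, b ≠ 0 → ∃ q r : R, a = b * q + r ∧ φ r < φ b) (b : R) : φ 0 ≤ φ b := by
  by_cases hb : b = 0
  · rw [hb]
  · exact (lt_of_ne_zero hφ hb).le

omit [WellFoundedLT W] in
/-- The remainder of `a` by `b` with `φ(r) < φ(b)` vanishes as soon as `φ(b)` is minimal among non-zero values.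
[cite: Samuel1971, Prop. 2 (p. 283)] -/
theorem dvd_of_forall_le (hφ : ∀ a b : R, b ≠ 0 → ∃ q r : R, a = b * q + r ∧ φ r < φ b) {b : R} (hb : b ≠ 0)
    (hmin : ∀ x : R, x ≠ 0 → φ b ≤ φ x) (a : R) : b ∣ a := by
  obtain ⟨q, r, hqr, hr⟩ := hφ a b hb
  by_cases hr0 : r = 0
  · exact ⟨q, by rw [hqr, hr0, add_zero]⟩
  · exact absurd hr (not_lt.mpr (hmin r hr0))

omit [WellFoundedLT W] in
/-- **Proposition 2**: an element `b ≠ 0` whose value is the smallest element of `φ(A) − φ(0)` (i.e. minimal among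
the values of non-zero elements) is a unit. [cite: Samuel1971, Prop. 2 (p. 283)] -/
theorem isUnit_of_forall_le (hφ : ∀ a b : R, b ≠ 0 → ∃ q r : R, a = b * q + r ∧ φ r < φ b) {b : R} (hb : b ≠ 0)
    (hmin : ∀ x : R, x ≠ 0 → φ b ≤ φ x) : IsUnit b :=
  isUnit_of_dvd_one (dvd_of_forall_le hφ hb hmin 1)

/-- **Proposition 3**: every ideal of a ring with a (transfinite) algorithm is principal — generated by a non-zero
element of smallest value. [cite: Samuel1971, Prop. 3 (p. 283)] -/
theorem isPrincipalIdealRing (hφ : ∀ a b : R, b ≠ 0 → ∃ q r : R, a = b * q + r ∧ φ r < φ b) :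
    IsPrincipalIdealRing R := by
  refine ⟨fun I ↦ ?_⟩
  by_cases hI : ∀ x ∈ I, x = 0
  · refine ⟨0, ?_⟩
    ext x
    simp only [Submodule.mem_span_singleton, smul_zero, exists_const]
    exact ⟨fun hx ↦ (hI x hx).symm, fun hx ↦ hx ▸ I.zero_mem⟩
  · push Not at hI
    -- a non-zero element of `I` with smallest value
    set S : Set W := {w | ∃ x ∈ I, x ≠ 0 ∧ φ x = w} with hS
    obtain ⟨x₀, hx₀I, hx₀⟩ := hI
    have hne : S.Nonempty := ⟨φ x₀, x₀, hx₀I, hx₀, rfl⟩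
    obtain ⟨b, hbI, hb0, hbφ⟩ := wellFounded_lt.min_mem S hne
    refine ⟨b, ?_⟩
    ext a
    simp only [Submodule.mem_span_singleton, smul_eq_mul]
    constructor
    · intro ha
      obtain ⟨q, r, hqr, hr⟩ := hφ a b hb0
      have hrI : r ∈ I := by
        have : r = a - b * q := by rw [hqr]; ring
        rw [this]
        exact I.sub_mem ha (I.mul_mem_right q hbI)
      by_cases hr0 : r = 0
      · exact ⟨q, by rw [hqr, hr0, add_zero, mul_comm]⟩
      · exact absurd (hbφ ▸ hr) (wellFounded_lt.not_lt_min S (show φ r ∈ S from ⟨r, hrI, hr0, rfl⟩))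
    · rintro ⟨c, rfl⟩
      exact I.mul_mem_left c hbI

omit [WellFoundedLT W] in
/-- **Corollary 1 to Proposition 4** (for any algorithm with the divisibility property (a) `φ(a) ≤ φ(ac)`,
`ac ≠ 0`): the value of a unit is the smallest element of `φ(A) − φ(0)`. [cite: Samuel1971, §2 Cor. 1 (p. 284)] -/
theorem forall_le_of_isUnit (hmono : ∀ a c : R, a * c ≠ 0 → φ a ≤ φ (a * c)) {u : R} (hu : IsUnit u)
    (x : R) (hx : x ≠ 0) : φ u ≤ φ x := by
  obtain ⟨v, rfl⟩ := hu
  have hx' : (v : R) * (↑v⁻¹ * x) = x := by rw [← mul_assoc, Units.mul_inv, one_mul]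
  have := hmono (v : R) (↑v⁻¹ * x) (by rwa [hx'])
  rwa [hx'] at this

/-- **Proposition 4** (normalised algorithm): for every algorithm `φ` there is an algorithm `φ₁` — namely
`φ₁(0) = φ(0)`, `φ₁(a) = min {φ(ac) : ac ≠ 0}` for `a ≠ 0` (the first two clauses determine `φ₁`) — with
(E), (a) `φ₁(a) ≤ φ₁(ac)` for `ac ≠ 0`, (b) `φ₁(ac) = φ₁(a) ↔ Aac = Aa` (for `ac ≠ 0`), (c) `φ₁ ≤ φ`.
[cite: Samuel1971, Prop. 4 (p. 284)] -/
theorem exists_normalised (hφ : ∀ a b : R, b ≠ 0 → ∃ q r : R, a = b * q + r ∧ φ r < φ b) :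
    ∃ φ₁ : R → W,
      φ₁ 0 = φ 0 ∧
      (∀ a : R, a ≠ 0 → (∃ c : R, a * c ≠ 0 ∧ φ₁ a = φ (a * c)) ∧ ∀ c : R, a * c ≠ 0 → φ₁ a ≤ φ (a * c)) ∧
      (∀ a b : R, b ≠ 0 → ∃ q r : R, a = b * q + r ∧ φ₁ r < φ₁ b) ∧
      (∀ a c : R, a * c ≠ 0 → φ₁ a ≤ φ₁ (a * c)) ∧
      (∀ a c : R, a * c ≠ 0 → (φ₁ (a * c) = φ₁ a ↔ Ideal.span {a * c} = Ideal.span {a})) ∧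
      (∀ a : R, φ₁ a ≤ φ a) := by
  classical
  -- the value sets `S a = {φ(ac) : ac ≠ 0}`
  let S : R → Set W := fun a ↦ {w | ∃ c : R, a * c ≠ 0 ∧ φ (a * c) = w}
  have hS : ∀ a : R, a ≠ 0 → (S a).Nonempty := fun a ha ↦ ⟨φ (a * 1), 1, by rwa [mul_one], rfl⟩
  let φ₁ : R → W := fun a ↦ if ha : a = 0 then φ 0 else wellFounded_lt.min (S a) (hS a ha)
  have h0 : φ₁ 0 = φ 0 := by simp [φ₁]
  have hdef : ∀ a : R, a ≠ 0 →
      (∃ c : R, a * c ≠ 0 ∧ φ₁ a = φ (a * c)) ∧ ∀ c : R, a * c ≠ 0 → φ₁ a ≤ φ (a * c) := by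
    intro a ha
    have e : φ₁ a = wellFounded_lt.min (S a) (hS a ha) := by simp [φ₁, ha]
    obtain ⟨c, hc, hcw⟩ := wellFounded_lt.min_mem (S a) (hS a ha)
    refine ⟨⟨c, hc, by rw [e, hcw]⟩, fun c' hc' ↦ ?_⟩
    rw [e]
    exact not_lt.mp (wellFounded_lt.not_lt_min (S a) (show φ (a * c') ∈ S a from ⟨c', hc', rfl⟩))
  -- (c) `φ₁ ≤ φ`
  have hc : ∀ a : R, φ₁ a ≤ φ a := by
    intro a
    by_cases ha : a = 0
    · rw [ha, h0]
    · simpa using (hdef a ha).2 1 (by rwa [mul_one])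
  -- (a) monotonicity
  have ha : ∀ a c : R, a * c ≠ 0 → φ₁ a ≤ φ₁ (a * c) := by
    intro a c hac
    have ha0 : a ≠ 0 := fun h ↦ hac (by rw [h, zero_mul])
    obtain ⟨d, hd, hdw⟩ := (hdef (a * c) hac).1
    rw [hdw, mul_assoc]
    exact (hdef a ha0).2 (c * d) (by rwa [← mul_assoc])
  -- (E) for `φ₁`
  have hE : ∀ a b : R, b ≠ 0 → ∃ q r : R, a = b * q + r ∧ φ₁ r < φ₁ b := by
    intro a b hb
    obtain ⟨c, hbc, hbw⟩ := (hdef b hb).1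
    obtain ⟨q, r, hqr, hr⟩ := hφ a (b * c) hbc
    refine ⟨c * q, r, by rw [hqr]; ring, ?_⟩
    rw [hbw]
    exact (hc r).trans_lt hr
  refine ⟨φ₁, h0, hdef, hE, ha, ?_, hc⟩
  -- (b)
  intro a c hac
  have ha0 : a ≠ 0 := fun h ↦ hac (by rw [h, zero_mul])
  constructor
  · intro heq
    -- divide `a` by `ac`: `a = (ac)q + r`, `φ₁ r < φ₁(ac) = φ₁ a`, `r = a(1 - cq)`
    obtain ⟨q, r, hqr, hr⟩ := hE a (a * c) hac
    have hr' : r = a * (1 - c * q) := by linear_combination -hqr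
    have hr0 : r = 0 := by
      by_contra hr0
      have := ha a (1 - c * q) (by rwa [← hr'])
      rw [← hr'] at this
      rw [heq] at hr
      exact absurd hr (not_lt.mpr this)
    apply le_antisymm (Ideal.span_singleton_le_span_singleton.mpr (Dvd.intro c rfl))
    rw [Ideal.span_singleton_le_span_singleton]
    exact ⟨q, by rw [hr0, add_zero] at hqr; exact hqr⟩
  · intro hspan
    have : a ∈ Ideal.span {a * c} := by rw [hspan]; exact Ideal.mem_span_singleton_self a
    obtain ⟨d, hd⟩ := Ideal.mem_span_singleton.mp this
    apply le_antisymm _ (ha a c hac)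
    have hacd : a * c * d ≠ 0 := by rw [← hd]; exact ha0
    have := ha (a * c) d hacd
    rwa [← hd] at this

end General

/-! ## The two integer examples of §2 -/

/-- The Remark after Corollary 1: `φ(n) = |n|` for `n ≠ 1`, `φ(1) = 2` is an algorithm on `ℤ` («use `0` and `−1`
as representatives mod `2`»), although the unit `1` does not have the smallest non-zero value (`φ(−1) = 1 < φ(1)`).
[cite: Samuel1971, §2 Remark (p. 284)] -/
theorem Int.remark_algorithm :
    (∀ a b : ℤ, b ≠ 0 → ∃ q r : ℤ, a = b * q + r ∧
      (if r = 1 then 2 else r.natAbs) < (if b = 1 then 2 else b.natAbs)) ∧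
    (if (-1 : ℤ) = 1 then 2 else (-1 : ℤ).natAbs) < (if (1 : ℤ) = 1 then 2 else (1 : ℤ).natAbs) := by
  refine ⟨fun a b hb ↦ ?_, by decide⟩
  have hdm := Int.emod_def a b
  have h1 := Int.emod_nonneg a hb
  have h2 := Int.emod_lt_abs a hb
  rw [← Int.natCast_natAbs] at h2
  by_cases hr1 : a % b = 1
  · -- remainder `1`: fine if `|b| ≥ 3` or `|b| = 1`; for `b = ±2` use `−1` instead
    by_cases hb2 : b.natAbs = 2
    · rcases Int.natAbs_eq b with h | h <;> rw [hb2] at h <;> push_cast at h <;> subst h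
      · exact ⟨a / 2 + 1, -1, by linear_combination -hdm + hr1, by decide⟩
      · exact ⟨a / (-2) - 1, -1, by linear_combination -hdm + hr1, by decide⟩
    · by_cases hb1 : b.natAbs = 1
      · -- `b = ±1` divides everything
        rcases Int.natAbs_eq b with h | h <;> rw [hb1] at h <;> push_cast at h <;> subst h
        · exact ⟨a, 0, by ring, by split_ifs <;> omega⟩
        · exact ⟨-a, 0, by ring, by split_ifs <;> omega⟩
      · refine ⟨a / b, a % b, by linear_combination -hdm, ?_⟩
        rw [if_pos hr1]
        split_ifs <;> omega
  · refine ⟨a / b, a % b, by linear_combination -hdm, ?_⟩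
    rw [if_neg hr1]
    split_ifs <;> omega

/-- **Example 1**: `φ(n) = |n|` for `|n| ≠ 5`, `φ(±5) = 13`… precisely Samuel's `φ(n) = |n|` for `n ≠ 5`,
`φ(5) = 13`, is an algorithm on `ℤ` («for `6 ≤ |n| ≤ 13` we replace the representative `5` by `5 − |n|`»).
[cite: Samuel1971, §2 Example 1 (p. 284)] -/
theorem Int.example1_algorithm :
    ∀ a b : ℤ, b ≠ 0 → ∃ q r : ℤ, a = b * q + r ∧
      (if r = 5 then 13 else r.natAbs) < (if b = 5 then 13 else b.natAbs) := by
  intro a b hb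
  have hdm := Int.emod_def a b
  have h1 := Int.emod_nonneg a hb
  have h2 := Int.emod_lt_abs a hb
  rw [← Int.natCast_natAbs] at h2
  by_cases hr5 : a % b = 5
  · by_cases hbig : 14 ≤ b.natAbs
    · refine ⟨a / b, a % b, by linear_combination -hdm, ?_⟩
      rw [if_pos hr5]; split_ifs <;> omega
    · -- `6 ≤ |b| ≤ 13`: use `5 - |b|`
      rcases Int.natAbs_eq b with h | h
      · refine ⟨a / b + 1, 5 - b, by linear_combination -hdm + hr5, ?_⟩
        split_ifs <;> omega
      · refine ⟨a / b - 1, 5 + b, by linear_combination -hdm + hr5, ?_⟩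
        split_ifs <;> omega
  · refine ⟨a / b, a % b, by linear_combination -hdm, ?_⟩
    rw [if_neg hr5]; split_ifs <;> omega

/-- …but it violates the divisibility condition: `φ(5) > φ(10)` (and `φ(5) > φ(−5)`).
[cite: Samuel1971, §2 Example 1 (p. 284)] -/
theorem Int.example1_not_monotone :
    (if (10 : ℤ) = 5 then 13 else (10 : ℤ).natAbs) < (if (5 : ℤ) = 5 then 13 else (5 : ℤ).natAbs) ∧
    (if (-5 : ℤ) = 5 then 13 else (-5 : ℤ).natAbs) < (if (5 : ℤ) = 5 then 13 else (5 : ℤ).natAbs) := by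
  decide

end Literature.Algebra.EuclideanDomain.Algorithm
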